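/- Copyright: the b2b-balaban cell (near-miss cell 7), T⁴-continuum fan-out, NE7b swarm leaf 04 (gen 5; road W-RP-VAR,
supplier «W3c»: the BASE reflection-positivity package of the torus Wilson state, in the tree's bounded-RP currency,
at every lattice hyperplane).  Released under the licence of the surrounding project. -/
import Summits.QuantumFields.BalabanUV.T4Continuum.Support.HistoryRPExtension
import Summits.QuantumFields.YangMills.Theorems.FradkinShenkerFlowFiniteSusceptibilityWeakCouplingRPCauchySchwarz

/-!
# History chessboard road: the BASE RP-package — the torus Wilson state in `IsReflectionPositiveBdd` currency

Summits-side support leaf of the T⁴-continuum cell (rung (B)+1 on a FINITE torus only; NOT infinite volume, NOT the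
mass gap, NOT the Clay statement; NOT a proof of the spine estimate NE7b).  Road W-RP-VAR of the swarm claim table
`t4/b2b-balaban-t4-ne7b-p1/LEAVES-NE7b.md` (owner ruling R-OWNER-23-2), supplier «W3c» (journal INTENT of leaf-04
g5): the BASE of the level-by-level iteration of `HistoryRPExtension.rpPackage_level` (sub-row W3b).  [folklore]
bookkeeping over the TREE'S OWN theorems, consumed BY NAME: Osterwalder–Seiler reflection positivity of the finite-volume
Wilson theory `wilsonExpectation_reflectionPositive_holds` (Literature `ConstructiveQFTWave0Proofs`, complex
observables, `IsPositiveTimeObservable`), the invariances of the torus Wilson state under the time reflection,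
translations and axis permutations (`RPCauchySchwarz.wilsonMeasure_map_timeReflect` ∕ `map_theta` of the Yang–Mills
Theorems module `FradkinShenkerFlowFiniteSusceptibilityWeakCouplingRPCauchySchwarz`; Literature
`wilsonMeasure_map_torusConfigShift`, `wilsonMeasure_map_configPerm`), and Mathlib's Doob–Dynkin lemma in the form
`Measurable.dependsOn_of_piFinset`.  No `def`, no `structure`, no `[cite:]` tag, nothing printed asserted, no Bałaban
object instantiated.

CURRENCY (as in W3b).  RP-package of `(μ, mP, θ)` := the five sentences `mP ≤ m`, `Measurable θ`,
`MeasurePreserving θ μ μ`, `θ ∘ θ = id`, `LatticeRP.IsReflectionPositiveBdd μ mP θ` (= W4b's `EventReading` fields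
`mP_le ∕ θ_meas ∕ θ_pres ∕ θ_invol ∕ rp` at one `(K, i, k)` = the first five binders of W5's
`HistoryChessboardRP.sq_le_symP_mul_symM_of_isReflectionPositiveBdd`).

WHAT.
* §1 (abstract) **`isReflectionPositiveBdd_conj`** ∕ **`rpPackage_conj`**: an RP-package is TRANSPORTED along a
  measure-preserving symmetry — for measurable `Φ, Ψ : Ω → Ω` with `Φ ∘ Ψ = id = Ψ ∘ Φ` and `μ.map Φ = μ`,
  RP-package`(μ, mP, θ)` ⇒ RP-package`(μ, mP.comap Φ, Ψ ∘ θ ∘ Φ)` (Doob–Dynkin `g = h ∘ Φ` by W3b's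
  `exists_eq_comp_of_measurable_comap`, then `∫ h(θ(Φω)) h(Φω) dμ = ∫ h(θω) h(ω) dμ`).
* §2 **`isReflectionPositiveBdd_wilson`**: for the torus Wilson state `wilsonMeasure ρ β` on `GaugeConfig d L G`
  (`Even L`, `Continuous ρ`, `0 ≤ β`), the positive σ-algebra `Filtration.piFinset WilsonRP.posEdges` (Mathlib: the
  product σ-algebra pulled back along the restriction to the links of the positive-time half `Λ₊ = {1 ≤ t ≤ L∕2}`) and
  the time reflection `GaugeConfig.timeReflect` between the slices `0 ∣ 1`: `IsReflectionPositiveBdd`.  Bridge: a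
  bounded `piFinset posEdges`-measurable real `g` depends only on the positive links (`Measurable.dependsOn_of_piFinset`),
  hence `(g : ℂ)` is an `IsPositiveTimeObservable` (`isPositiveTimeObservable_of_dependsOn`, the converse of the tree's
  `WilsonRP.dependsOn_of_isPositiveTimeObservable`), and `wilsonExpectation_reflectionPositive_holds` gives
  `0 ≤ ↑(∫ g(Θ₀U) g(U) dμ)` in `ℂ`.  **`rpPackage_wilson`** = the five sentences.
* §3 **`rpPackage_wilson_theta π v`**: the five sentences at EVERY hyperplane «axis `π 0`, between the slices
  `v (π 0) ∣ v (π 0) + 1`» — §1 with `Φ := π_*⁻¹ ∘ τ_{−v}`, `Ψ := τ_v ∘ π_*`; the reflection is LITERALLY the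
  Yang–Mills module's transported reflection `Θ_{π,v} U = τ_v (π_* (Θ₀ (π_*⁻¹ (τ_{−v} U))))`, so `map_theta`,
  `theta_theta`, `measurable_theta` are consumed BY NAME.
* §4 sanity: base + one level of W3b type-check together (`example`).

WHAT IT BUYS (honest).  With W3b, row W4b's displayed RP-package of the EXTENDED state at cutoff `K` and block
hyperplane `(i, k)` reduces BY NAME to: (a) the identification of the run's fine-link state with `wilsonMeasure ρ β`
on the tree's `GaugeConfig d L G`, `L` even (a DISPLAYED sentence — the cell's `Setup` tori are a different vocabulary,
cf. `TorusLimitAxioms` «in a vocabulary not transported to `Setup`'s tori»), and (b) per level the (VAR)-shaped kernel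
structure (i)–(iii) of `HistoryRPExtension.rpPackage_level`.  Nothing of Bałaban is instantiated, no `Prop` fact is
minted (trigger c1), no constant (c2∕c6) and no exit ∕ socket ∕ `HistoryConstants` file (c3) is touched.  NE7b NOT
proved; spine 0∕9.  HONEST DEPENDENCY (cell): continuum YM on T⁴ ⇐ BetaPertH ∧ nine spine estimates (0/9 proved);
BetaPertH ⇐ (D1) ∧ (D4) ∧ CAP+tail; G-an2-4 gates asym, D1 and NE2/3/4.  This file changes none of it. -/

open MeasureTheory
open Literature.MathematicalPhysics.QuantumFieldTheory
open Literature.MathematicalPhysics.QuantumFieldTheory.LatticeRP (IsReflectionPositiveBdd)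
open Summit.QuantumFields.YangMills.Theorems.FiniteSusceptibilityWeakCoupling

namespace Summit.QuantumFields.BalabanUV.T4Continuum.HistoryRPBase

noncomputable section

/-! ## §1 Transport of an RP-package along a measure-preserving symmetry -/

section Conj

variable {Ω : Type*} {mP : MeasurableSpace Ω} [m : MeasurableSpace Ω] {μ : Measure Ω} {θ Φ Ψ : Ω → Ω}

omit m in
/-- A conjugate `Ψ ∘ θ ∘ Φ` of an involution `θ` by mutually inverse maps `Φ, Ψ` is an involution. [folklore] -/
theorem conj_comp_self (hθθ : θ ∘ θ = id) (hΦΨ : ∀ ω, Φ (Ψ ω) = ω) (hΨΦ : ∀ ω, Ψ (Φ ω) = ω) :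
    ((fun ω => Ψ (θ (Φ ω))) ∘ fun ω => Ψ (θ (Φ ω))) = id := by
  funext ω
  have hθ2 : ∀ a, θ (θ a) = a := fun a => congrFun hθθ a
  simp only [Function.comp_apply, hΦΨ, hθ2, hΨΦ, id_eq]

/-- If `μ.map Φ = μ` and `Ψ` is a measurable left inverse of the measurable `Φ`, then `μ.map Ψ = μ`. [folklore] -/
theorem map_eq_of_inverse (hΦm : Measurable Φ) (hΨm : Measurable Ψ) (hΦμ : μ.map Φ = μ)
    (hΨΦ : ∀ ω, Ψ (Φ ω) = ω) : μ.map Ψ = μ := by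
  have hΨΦ' : Ψ ∘ Φ = id := funext hΨΦ
  calc μ.map Ψ = (μ.map Φ).map Ψ := by rw [hΦμ]
    _ = μ.map (Ψ ∘ Φ) := Measure.map_map hΨm hΦm
    _ = μ := by rw [hΨΦ', Measure.map_id]

/-- The conjugated reflection `Ψ ∘ θ ∘ Φ` preserves `μ` when `θ` and `Φ` do and `Ψ` is the inverse of `Φ`.
[folklore] -/
theorem measurePreserving_conj (hθ : MeasurePreserving θ μ μ) (hΦm : Measurable Φ) (hΨm : Measurable Ψ)
    (hΦμ : μ.map Φ = μ) (hΨΦ : ∀ ω, Ψ (Φ ω) = ω) :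
    MeasurePreserving (fun ω => Ψ (θ (Φ ω))) μ μ :=
  (⟨hΨm, map_eq_of_inverse hΦm hΨm hΦμ hΨΦ⟩ : MeasurePreserving Ψ μ μ).comp (hθ.comp ⟨hΦm, hΦμ⟩)

/-- The transported positive σ-algebra `mP.comap Φ` is a sub-σ-algebra of the ambient one. [folklore] -/
theorem comap_le_of_measurable (hm : mP ≤ m) (hΦm : Measurable Φ) : mP.comap Φ ≤ m :=
  (MeasurableSpace.comap_mono hm).trans hΦm.comap_le

/-- **REFLECTION POSITIVITY IS TRANSPORTED ALONG A MEASURE-PRESERVING SYMMETRY.**  If `μ` is reflection positive in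
the bounded form for `(mP, θ)`, `Φ` is measurable with `μ.map Φ = μ` and `Ψ` is a right inverse of `Φ`
(`Φ (Ψ ω) = ω`), then `μ` is reflection positive for the pulled-back positive σ-algebra `mP.comap Φ` and the
conjugated reflection `Ψ ∘ θ ∘ Φ`: a bounded `mP.comap Φ`-measurable observable is `h ∘ Φ` with `h` bounded and
`mP`-measurable (Doob–Dynkin, W3b's `exists_eq_comp_of_measurable_comap`), and
`∫ h(Φ Ψ θ Φ ω) h(Φ ω) dμ = ∫ h(θ (Φ ω)) h(Φ ω) dμ = ∫ h(θ ω) h(ω) dμ ≥ 0`. [folklore] -/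
theorem isReflectionPositiveBdd_conj (hm : mP ≤ m) (hθm : Measurable θ) (hRP : IsReflectionPositiveBdd μ mP θ)
    (hΦm : Measurable Φ) (hΦμ : μ.map Φ = μ) (hΦΨ : ∀ ω, Φ (Ψ ω) = ω) :
    IsReflectionPositiveBdd μ (mP.comap Φ) (fun ω => Ψ (θ (Φ ω))) := by
  intro g hg hgb
  show 0 ≤ ∫ ω, g (Ψ (θ (Φ ω))) * g ω ∂μ
  obtain ⟨C, hC⟩ := hgb
  obtain ⟨h, hmeas, hbdd, hgh⟩ := HistoryRPExtension.exists_eq_comp_of_measurable_comap hg hC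
  have hmeas' : Measurable h := hmeas.mono hm le_rfl
  have hG : (fun ω => g (Ψ (θ (Φ ω))) * g ω) = fun ω => (fun a => h (θ a) * h a) (Φ ω) := by
    funext ω; rw [hgh, hgh, hΦΨ]
  rw [hG, RPCauchySchwarz.integral_comp_eq hΦm hΦμ (H := fun a => h (θ a) * h a) ((hmeas'.comp hθm).mul hmeas')]
  exact hRP h hmeas ⟨_, hbdd⟩

/-- **PACKAGED: RP-package in ⇒ RP-package out** under conjugation by a measure-preserving symmetry `Φ` with
measurable inverse `Ψ`. [folklore] -/
theorem rpPackage_conj (hm : mP ≤ m) (hθm : Measurable θ) (hθ : MeasurePreserving θ μ μ) (hθθ : θ ∘ θ = id)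
    (hRP : IsReflectionPositiveBdd μ mP θ) (hΦm : Measurable Φ) (hΨm : Measurable Ψ) (hΦμ : μ.map Φ = μ)
    (hΦΨ : ∀ ω, Φ (Ψ ω) = ω) (hΨΦ : ∀ ω, Ψ (Φ ω) = ω) :
    mP.comap Φ ≤ m ∧ Measurable (fun ω => Ψ (θ (Φ ω))) ∧
      MeasurePreserving (fun ω => Ψ (θ (Φ ω))) μ μ ∧
      ((fun ω => Ψ (θ (Φ ω))) ∘ fun ω => Ψ (θ (Φ ω))) = id ∧
      IsReflectionPositiveBdd μ (mP.comap Φ) (fun ω => Ψ (θ (Φ ω))) :=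
  ⟨comap_le_of_measurable hm hΦm, hΨm.comp (hθm.comp hΦm), measurePreserving_conj hθ hΦm hΨm hΦμ hΨΦ,
    conj_comp_self hθθ hΦΨ hΨΦ, isReflectionPositiveBdd_conj hm hθm hRP hΦm hΦμ hΦΨ⟩

end Conj

/-! ## §2 The base package: the torus Wilson state across the time hyperplane `0 ∣ 1` -/

section Wilson

variable {d L N : ℕ} [NeZero d] [NeZero L] {G : Type*} [Group G] [TopologicalSpace G] [IsTopologicalGroup G]
  [CompactSpace G] [MeasurableSpace G] [BorelSpace G] (ρ : G →* Matrix (Fin N) (Fin N) ℂ)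

omit [Group G] [TopologicalSpace G] [IsTopologicalGroup G] [CompactSpace G] [MeasurableSpace G] [BorelSpace G] in
/-- An observable depending only on the links of the positive-time half `Λ₊` is a positive-time observable in the
sense of the tree's `IsPositiveTimeObservable` (the converse of `WilsonRP.dependsOn_of_isPositiveTimeObservable`;
`WilsonRP.IsPosEdge` is the conjunction of the four clauses of that definition). [folklore] -/
theorem isPositiveTimeObservable_of_dependsOn {α : Type*} {F : GaugeConfig d L G → α}
    (hF : DependsOn F ((WilsonRP.posEdges : Finset (Edge d L)) : Set (Edge d L))) :
    IsPositiveTimeObservable F := by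
  intro U V hUV
  refine hF fun e he => ?_
  rw [Finset.mem_coe, WilsonRP.mem_posEdges] at he
  exact hUV e he.1 he.2.1 he.2.2.1 he.2.2.2

/-- **THE TORUS WILSON STATE IS REFLECTION POSITIVE IN THE TREE'S BOUNDED FORM** across the hyperplane between the
time slices `0 ∣ 1` (`L` even, `ρ` continuous, `β ≥ 0`), for the positive σ-algebra
`Filtration.piFinset WilsonRP.posEdges` of the links of `Λ₊ = {1 ≤ t ≤ L∕2}`: Osterwalder–Seiler positivity
`wilsonExpectation_reflectionPositive_holds` (stated in the tree for bounded measurable COMPLEX positive-time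
observables) applied to the real observable `g` read as complex; `Measurable[piFinset posEdges] g` makes `g` depend on
the positive links only (Mathlib's Doob–Dynkin `Measurable.dependsOn_of_piFinset`). [folklore] -/
theorem isReflectionPositiveBdd_wilson (hL : Even L) (hρ : Continuous ρ) {β : ℝ} (hβ : 0 ≤ β) :
    IsReflectionPositiveBdd (wilsonMeasure (d := d) (L := L) ρ β)
      (Filtration.piFinset (X := fun _ : Edge d L => G) WilsonRP.posEdges)
      GaugeConfig.timeReflect := by
  intro g hg hgb
  obtain ⟨C, hC⟩ := hgb
  have hle : (Filtration.piFinset (X := fun _ : Edge d L => G) WilsonRP.posEdges :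
      MeasurableSpace (GaugeConfig d L G)) ≤ MeasurableSpace.pi :=
    (Filtration.piFinset (X := fun _ : Edge d L => G)).le WilsonRP.posEdges
  have hg' : Measurable g := hg.mono hle le_rfl
  have hdep : DependsOn g ((WilsonRP.posEdges : Finset (Edge d L)) : Set (Edge d L)) :=
    hg.dependsOn_of_piFinset
  -- the complexified observable
  have hF : Measurable fun U : GaugeConfig d L G => (g U : ℂ) := Complex.measurable_ofReal.comp hg'
  have hFb : ∃ C : ℝ, ∀ U : GaugeConfig d L G, ‖(g U : ℂ)‖ ≤ C :=
    ⟨C, fun U => by rw [Complex.norm_real, Real.norm_eq_abs]; exact hC U⟩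
  have hFpos : IsPositiveTimeObservable fun U : GaugeConfig d L G => (g U : ℂ) :=
    isPositiveTimeObservable_of_dependsOn fun U V hUV => by simp only [hdep hUV]
  have h := wilsonExpectation_reflectionPositive_holds (d := d) (L := L) ρ hL hρ hβ _ hF hFb hFpos
  -- read the complex expectation as the real integral
  have hid : wilsonExpectation ρ β (fun U : GaugeConfig d L G =>
      (starRingEnd ℂ) ((g U.timeReflect : ℝ) : ℂ) * (g U : ℂ)) =
      ((∫ U, g U.timeReflect * g U ∂(wilsonMeasure (d := d) (L := L) ρ β) : ℝ) : ℂ) := by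
    unfold wilsonExpectation
    rw [← integral_complex_ofReal]
    refine integral_congr_ae (ae_of_all _ fun U => ?_)
    simp only [Complex.conj_ofReal, Complex.ofReal_mul]
  rw [hid] at h
  exact Complex.zero_le_real.1 h

/-- **THE BASE RP-PACKAGE** of the torus Wilson state across the time hyperplane `0 ∣ 1`: the five sentences
`piFinset posEdges ≤ m`, `Measurable Θ₀`, `MeasurePreserving Θ₀`, `Θ₀ ∘ Θ₀ = id`, `IsReflectionPositiveBdd` — the
input of `HistoryRPExtension.rpPackage_level` at level `0` (tree BY NAME: `Filtration.le`,
`WilsonRP.measurable_timeReflect`, `RPCauchySchwarz.wilsonMeasure_map_timeReflect`,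
`RPCauchySchwarz.timeReflect_timeReflect`, §2). [folklore] -/
theorem rpPackage_wilson (hL : Even L) (hρ : Continuous ρ) {β : ℝ} (hβ : 0 ≤ β) :
    (Filtration.piFinset (X := fun _ : Edge d L => G) WilsonRP.posEdges :
        MeasurableSpace (GaugeConfig d L G)) ≤ MeasurableSpace.pi ∧
      Measurable (GaugeConfig.timeReflect : GaugeConfig d L G → GaugeConfig d L G) ∧
      MeasurePreserving GaugeConfig.timeReflect (wilsonMeasure (d := d) (L := L) ρ β)
        (wilsonMeasure (d := d) (L := L) ρ β) ∧
      (GaugeConfig.timeReflect ∘ GaugeConfig.timeReflect : GaugeConfig d L G → GaugeConfig d L G) = id ∧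
      IsReflectionPositiveBdd (wilsonMeasure (d := d) (L := L) ρ β)
        (Filtration.piFinset (X := fun _ : Edge d L => G) WilsonRP.posEdges) GaugeConfig.timeReflect :=
  ⟨(Filtration.piFinset (X := fun _ : Edge d L => G)).le WilsonRP.posEdges, WilsonRP.measurable_timeReflect,
    ⟨WilsonRP.measurable_timeReflect, RPCauchySchwarz.wilsonMeasure_map_timeReflect ρ hρ β⟩,
    funext RPCauchySchwarz.timeReflect_timeReflect, isReflectionPositiveBdd_wilson ρ hL hρ hβ⟩

/-! ## §3 The base package at every lattice hyperplane: axis `π 0`, between the slices `v (π 0) ∣ v (π 0) + 1` -/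

omit [NeZero d] in
/-- The torus symmetry `Φ = π_*⁻¹ ∘ τ_{−v}` preserves the Wilson state (tree: translation and axis-permutation
invariance, `wilsonMeasure_map_torusConfigShift`, `wilsonMeasure_map_configPerm`). [folklore] -/
theorem map_phi (hρ : Continuous ρ) (β : ℝ) (π : Equiv.Perm (Fin d)) (v : Site d L) :
    (wilsonMeasure (d := d) (L := L) ρ β).map
        (fun U : GaugeConfig d L G => configPerm π.symm (torusConfigShift (-v) U)) =
      wilsonMeasure (d := d) (L := L) ρ β := by
  have hcomp : (fun U : GaugeConfig d L G => configPerm π.symm (torusConfigShift (-v) U)) =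
      (configPerm π.symm : GaugeConfig d L G → GaugeConfig d L G) ∘ (torusConfigShift (-v)) := rfl
  rw [hcomp, ← Measure.map_map (configPerm π.symm).measurable (torusConfigShift (-v)).measurable,
    wilsonMeasure_map_torusConfigShift, wilsonMeasure_map_configPerm ρ hρ]

/-- **THE BASE RP-PACKAGE AT EVERY LATTICE HYPERPLANE.**  For an axis permutation `π` and a translation `v`, the
torus Wilson state (`L` even, `ρ` continuous, `β ≥ 0`) carries the five sentences for the positive σ-algebra
`(piFinset posEdges).comap (π_*⁻¹ ∘ τ_{−v})` (the links of the transported positive half) and the transported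
reflection `Θ_{π,v} U = τ_v (π_* (Θ₀ (π_*⁻¹ (τ_{−v} U))))` of the Yang–Mills Theorems module (its `map_theta`,
`theta_theta`, `measurable_theta` BY NAME; the RP sentence by §1 from §2). [folklore] -/
theorem rpPackage_wilson_theta (hL : Even L) (hρ : Continuous ρ) {β : ℝ} (hβ : 0 ≤ β)
    (π : Equiv.Perm (Fin d)) (v : Site d L) :
    ((Filtration.piFinset (X := fun _ : Edge d L => G) WilsonRP.posEdges :
        MeasurableSpace (GaugeConfig d L G)).comap
          (fun U : GaugeConfig d L G => configPerm π.symm (torusConfigShift (-v) U))) ≤ MeasurableSpace.pi ∧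
      Measurable (fun U : GaugeConfig d L G => torusConfigShift v (configPerm π
        (GaugeConfig.timeReflect (configPerm π.symm (torusConfigShift (-v) U))))) ∧
      MeasurePreserving (fun U : GaugeConfig d L G => torusConfigShift v (configPerm π
          (GaugeConfig.timeReflect (configPerm π.symm (torusConfigShift (-v) U)))))
        (wilsonMeasure (d := d) (L := L) ρ β) (wilsonMeasure (d := d) (L := L) ρ β) ∧
      ((fun U : GaugeConfig d L G => torusConfigShift v (configPerm π
          (GaugeConfig.timeReflect (configPerm π.symm (torusConfigShift (-v) U))))) ∘
        fun U : GaugeConfig d L G => torusConfigShift v (configPerm π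
          (GaugeConfig.timeReflect (configPerm π.symm (torusConfigShift (-v) U))))) = id ∧
      IsReflectionPositiveBdd (wilsonMeasure (d := d) (L := L) ρ β)
        ((Filtration.piFinset (X := fun _ : Edge d L => G) WilsonRP.posEdges :
            MeasurableSpace (GaugeConfig d L G)).comap
          (fun U : GaugeConfig d L G => configPerm π.symm (torusConfigShift (-v) U)))
        (fun U : GaugeConfig d L G => torusConfigShift v (configPerm π
          (GaugeConfig.timeReflect (configPerm π.symm (torusConfigShift (-v) U))))) := by
  obtain ⟨hm, hθm, -, -, hRP⟩ := rpPackage_wilson (d := d) (L := L) ρ hL hρ hβ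
  have hΦm : Measurable fun U : GaugeConfig d L G => configPerm π.symm (torusConfigShift (-v) U) :=
    (configPerm π.symm).measurable.comp (torusConfigShift (-v)).measurable
  have hΦΨ : ∀ U : GaugeConfig d L G,
      configPerm π.symm (torusConfigShift (-v) (torusConfigShift v (configPerm π U))) = U := fun U => by
    rw [RPCauchySchwarz.torusConfigShift_neg_shift, RPCauchySchwarz.configPerm_symm_configPerm]
  refine ⟨comap_le_of_measurable hm hΦm, RPCauchySchwarz.measurable_theta π v,
    ⟨RPCauchySchwarz.measurable_theta π v, RPCauchySchwarz.map_theta ρ hρ β π v⟩,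
    funext (RPCauchySchwarz.theta_theta π v), ?_⟩
  exact isReflectionPositiveBdd_conj (Ψ := fun U : GaugeConfig d L G => torusConfigShift v (configPerm π U))
    hm hθm hRP hΦm (map_phi ρ hρ β π v) hΦΨ

end Wilson

/-! ## §4 Sanity: the base package feeds one level of W3b BY NAME -/

section Sanity

open ProbabilityTheory

variable {d L N : ℕ} [NeZero d] [NeZero L] {G : Type*} [Group G] [TopologicalSpace G] [IsTopologicalGroup G]
  [CompactSpace G] [MeasurableSpace G] [BorelSpace G] (ρ : G →* Matrix (Fin N) (Fin N) ℂ)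

/-- BASE + ONE LEVEL: the base package at the hyperplane `(π, v)` (§3) followed by one level of
`HistoryRPExtension.rpPackage_level` (own-half block-bond kernel `κ` reading the transported positive links,
crossing kernel `η` covariant under the transported reflection) yields the bounded reflection positivity of the
once-extended state — a pure composition BY NAME (type-check only). [folklore] -/
example (hL : Even L) (hρ : Continuous ρ) {β : ℝ} (hβ : 0 ≤ β) (π : Equiv.Perm (Fin d)) (v : Site d L)
    {Y Z : Type*} [mY : MeasurableSpace Y] [MeasurableSpace Z] (κ : Kernel (GaugeConfig d L G) Y)
    [IsMarkovKernel κ]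
    (hκ : Measurable[((Filtration.piFinset (X := fun _ : Edge d L => G) WilsonRP.posEdges :
        MeasurableSpace (GaugeConfig d L G)).comap
          (fun U : GaugeConfig d L G => configPerm π.symm (torusConfigShift (-v) U)))]
        (κ : GaugeConfig d L G → Measure Y))
    (η : Kernel (GaugeConfig d L G × (Y × Y)) Z) [IsMarkovKernel η] {τ : Z → Z} (hτ : Measurable τ)
    (hττ : τ ∘ τ = id)
    (hcov : ∀ p : GaugeConfig d L G × (Y × Y), η (torusConfigShift v (configPerm π
      (GaugeConfig.timeReflect (configPerm π.symm (torusConfigShift (-v) p.1)))), p.2.swap) = (η p).map τ) :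
    IsReflectionPositiveBdd
      (((wilsonMeasure (d := d) (L := L) ρ β) ⊗ₘ
          (κ ×ₖ κ.comap _ (RPCauchySchwarz.measurable_theta (G := G) π v))) ⊗ₘ η)
      (((((Filtration.piFinset (X := fun _ : Edge d L => G) WilsonRP.posEdges :
          MeasurableSpace (GaugeConfig d L G)).comap
            (fun U : GaugeConfig d L G => configPerm π.symm (torusConfigShift (-v) U))).prod mY).comap
          (fun p : GaugeConfig d L G × (Y × Y) => (p.1, p.2.1))).comap
        (Prod.fst : (GaugeConfig d L G × (Y × Y)) × Z → GaugeConfig d L G × (Y × Y)))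
      (fun q : (GaugeConfig d L G × (Y × Y)) × Z => ((torusConfigShift v (configPerm π
        (GaugeConfig.timeReflect (configPerm π.symm (torusConfigShift (-v) q.1.1)))), q.1.2.swap), τ q.2)) := by
  haveI := isProbabilityMeasure_wilsonMeasure (d := d) (L := L) ρ hρ β
  obtain ⟨h1, h2, h3, h4, h5⟩ := rpPackage_wilson_theta (d := d) (L := L) ρ hL hρ hβ π v
  exact (HistoryRPExtension.rpPackage_level h1 h2 h3 h4 h5 κ hκ η hτ hττ hcov).2.2.2.2

end Sanity

end

end Summit.QuantumFields.BalabanUV.T4Continuum.HistoryRPBase
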